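/-
Copyright (c) 2026 the pub-hodgecm-mathlib formalisation cell (harness21).  Prover seat hodgecm-mathlib-K2E1-p12 (g2), Track B ∕ K2-LIT, h413 = `stmt-HodgeConjecture-24833`,
line `K2_E1_TraceFormulaBeta`, dealer K2E1-plan (g7) ruling (255): the M1 DISCHARGE of the survivor `hdec′` of ★ B1 p860535 `K2E1ChiMaassSelbergPairingFamilyCMTwo` — the decay
`‖E(f′_{z′}) − E_B(f′_{z′})‖ ≤ M₁` on `{H > T}` for a `χ`-section `φ′ ∈ V(χ, K_max, 1)` with `φ′ ∘ ι_∞ = φ′(1)` of `U(1,1)_{L∕L⁺}`.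
-/
import Summits.HodgeConjecture.HodgeConjecture.Theorems.K2E1KFiniteArchSmoothU2                 -- ★ (K2E1-p09): `lineSymbol_of_archConstant`, `exists_archSmooth_flatSectionU_of_lineSymbol_cm_two`; brings ★ p857911 `…_of_archSmooth`
import Summits.HodgeConjecture.HodgeConjecture.Theorems.K2E1ChiConvDataLettersMaximalLevelU2     -- ★ (K2E1-p14 g0): `apply_eq_apply_one_of_sndHom_mem` (M1 sections are constant on `{g_f ∈ GL₂(𝒪̂_L)}`)
import Summits.HodgeConjecture.HodgeConjecture.Theorems.K2E1ChiSectionBridgeU2                  -- ★ `IsChiSection.borelLaw_flatSectionU` (the `hf` letter), `IsChiSection.toAdelic_mul` (the `hφB` letter)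
import Literature.NumberTheory.Automorphic.UnitaryGroupIwasawaAdelic                           -- ★ `exists_mem_borelAdelic_mul_mem_standardMaximalCompactGL_cm` (adelic Iwasawa, CM pair)
import Literature.NumberTheory.Automorphic.UnitaryGroupLineKAverageArchSmoothTwo               -- ★ `coe_adelicVal_middleRootUnipotent_two` (`π(n b) = 1 + b E₀₁`)
import Literature.NumberTheory.Automorphic.UnitaryGroupLineUnipotentTwo                        -- ★ `middleRootUnipotent_add_two`
import Literature.NumberTheory.NumberFields.CMFieldTotallyNegativeGenerator                    -- ★ `IsCMField.exists_complexConj_ne` (a `δ ≠ 0` with `conj δ = −δ`)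
import HarnessLib

/-!
# K2·E1 — `K2E1ChiMaassSelbergDecayLetterM1CMTwo`: THE DECAY LETTER `hdec′` OF THE χ-MAASS–SELBERG PAIRING, DISCHARGED FOR M1 SECTIONS (`K = K_max`, `χ_∞ = 1`, `φ′ ∘ ι_∞ = φ′(1)`)

Track B ∕ K2-LIT, crux h413 = `stmt-HodgeConjecture-24833`, route `HCCMUnconditional`; cell `hodgecm-mathlib`, squad K2, ENGINE E1; dealer K2E1-plan (g7) (255) (taking over K2E4-p10's
(b)); consumers ★ B1 p860535 (`hdec'` binder, bytes verbatim in §4), ★ B2 p860605, K2E1-p13 (g3)'s (MS)_χ assembly at M1 (`hreal`∕`hs`).  THEOREMS ONLY (no `def`, no `instance`, no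
notation, no named-fact hypothesis, no `sorry`); lane `--supports stmt-HodgeConjecture-24833 --as helper` (count-neutral).  Closes no socket.

THE MATHEMATICS ([MoeglinWaldspurger1995, I.2.10–I.2.13, II.1.5, II.1.7]; [Garrett2018, §2.2, §2.10]).  ★ p857911 `exists_bound_sub_borelConstantTerm_level_cm_two_of_archSmooth` bounds
`E(f_z) − E_B(f_z)` on `{H > T}` (`1 < Re z`, `T ≥ 1`) for any flat section `f_z = φ·H^z` given: continuity and a bound for `φ`, left `B(F)`-invariance (`hφB`), the Borel law of `f_z`
(`hf`), right-invariance under an open compact of `G(𝔸_f)` (`hφU`), and ONE archimedean input `hφarch` — `C^m` smoothness with symbol bounds of `f_z` along the big-cell line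
`s ↦ ι(w₀)·n(θ(ι⁻¹ s, b))·k` (`m > [L⁺:ℚ]`).  For a section `φ ∈ V(χ, K_max, 1)` with `φ ∘ ι_∞ = φ(1)` (the M1 families of the 5Res (b) block): `hφB`, `hf` are ★
(`IsChiSection.toAdelic_mul`, `IsChiSection.borelLaw_flatSectionU`), `hφU` at `U₀ = GL₂(𝒪̂_L)` is the trivial `K_max`-type, and `hφarch` follows from ★ `K2E1KFiniteArchSmoothU2`
(`lineSymbol_of_archConstant` ∘ `exists_archSmooth_flatSectionU_of_lineSymbol_cm_two`) once `φ` is CONSTANT ALONG THE arch (↥(maximalRealSubfield L)) L (IsCMField.complexConj L) 2 ((StdForm.antidiagonal 2).over L)IMEDEAN LINE (§2): `θ(a, b) = θ(0, b) + θ(a, 0)`, so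
`ι(w₀)·n(θ(a,b))·k = (ι(w₀)·n(θ(0,b)))·(n(θ(a,0))·k)` where the second factor has finite component in `GL₂(𝒪̂_L)` (the finite part of `n(θ(a,0))` is `1`), and an M1 section is
right-invariant under such elements (§1: adelic Iwasawa `Y = βκ`, `φ(βκg) = χ(β₀₀)φ(κg) = χ(β₀₀)φ(1)` by ★ `apply_eq_apply_one_of_sndHom_mem`).
* §1 `apply_mul_eq_of_sndHom_mem` · §2 `snd_coe_traceZeroLine_inl`, `sndHom_adelicVal_middleRootUnipotent_inl`, `apply_line_eq_maximalLevel` · §3 `exists_archSmooth_flatSectionU_maximalLevel_cm_two`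
  (`hφarch` for M1 sections) · §4 HEAD **`hdec'_maximalLevel_cm_two`** (★ B1's `hdec'` clause, structures chosen inside as in ★ `K2E1MaassSelbergCMTwoFinal`).
HONEST LABEL: HC_CM is proved only modulo the 7 printed citations (2 remaining named inputs: hLiu418 = `stmt-HodgeConjecture-24832`, h413 = `stmt-HodgeConjecture-24833`) until rung 0
closes; count-neutral helper, closes no socket; the only hypotheses on `φ′` are membership in `V(χ, K_max, 1)`, continuity, a bound, and the M1 condition `φ′ ∘ ι_∞ = φ′(1)`.

## References
* [MoeglinWaldspurger1995] C. Mœglin, J.-L. Waldspurger, *Spectral Decomposition and Eisenstein Series* (1995), I.2.10–I.2.13, II.1.5, II.1.7.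
* [Garrett2018] P. Garrett, *Modern Analysis of Automorphic Forms by Example* (2018), §2.2, §2.10.
* [Langlands1976] R. P. Langlands, *On the Functional Equations Satisfied by Eisenstein Series*, LNM 544 (1976), §6.
-/

set_option autoImplicit false
-- the mandated namespace repeats `HodgeConjecture.HodgeConjecture`, as in every `Theorems/*.lean` of this sub-problem
set_option linter.dupNamespace false

noncomputable section

open MeasureTheory Measure NumberField NumberField.InfinitePlace NumberField.mixedEmbedding IsDedekindDomain Set Filter Topology Module
open scoped NNReal ENNReal ContDiff Classical
open Literature.NumberTheory Literature.NumberTheory.Automorphic Literature.NumberTheory.Automorphic.UnitaryGroup AdelicGroupData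
open Literature.NumberTheory.GaloisRepresentations (HeckeCharacter)
open Summit.HodgeConjecture.HodgeConjecture.Cruxes.H413.K2E1BorelEisensteinU
open Summit.HodgeConjecture.HodgeConjecture.Cruxes.H413.K2E1CharacterEisensteinU2Defs
open Summit.HodgeConjecture.HodgeConjecture.Cruxes.H413.K2E1ChiSectionSpaceU2Defs
open Summit.HodgeConjecture.HodgeConjecture.Cruxes.H413.K2E1HeightBigCellLineFormulaU2
open Summit.HodgeConjecture.HodgeConjecture.Cruxes.H413.K2E1KFiniteArchSmoothU2 (lineSymbol_of_archConstant exists_archSmooth_flatSectionU_of_lineSymbol_cm_two)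
open Summit.HodgeConjecture.HodgeConjecture.Cruxes.H413.K2E1EisensteinMinusConstantTermBoundedLevelCMTwo (exists_bound_sub_borelConstantTerm_level_cm_two_of_archSmooth)
open Summit.HodgeConjecture.HodgeConjecture.Cruxes.H413.K2E1ChiConvDataLettersMaximalLevelU2 (apply_eq_apply_one_of_sndHom_mem)

namespace Summit.HodgeConjecture.HodgeConjecture.Cruxes.H413.K2E1ChiMaassSelbergDecayLetterM1CMTwo

variable (L : Type) [Field L] [NumberField L] [IsCMField L]
  (hij : (((0 : Fin 2) : ℕ)) + 1 = ((1 : Fin 2) : ℕ)) (hN : 2 = 2 * ((0 : Fin 2) : ℕ) + 2)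

/-! ## §1 M1 sections are right-invariant under elements with finite component in `GL₂(𝒪̂_L)` -/

/-- **RIGHT-INVARIANCE OF M1 SECTIONS UNDER `{g : g_f ∈ GL₂(𝒪̂_L)}`** (in particular under every purely archimedean element): for `φ ∈ V(χ, K_max, 1)` with `φ ∘ ι_∞ = φ(1)`,
`φ(Y·g) = φ(Y)` whenever the finite component of `g` lies in `GL₂(𝒪̂_L)` (adelic Iwasawa `Y = βκ`, `φ(βκg) = χ(β₀₀)·φ(κg)`, and `φ(κg) = φ(1) = φ(κ)` by ★ `apply_eq_apply_one_of_sndHom_mem`).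
[cite: MoeglinWaldspurger1995, I.2.17, II.1.5] [cite: Langlands1976, §6] -/
theorem apply_mul_eq_of_sndHom_mem {χ : HeckeCharacter L} {φ : (quasiSplit (↥(maximalRealSubfield L)) L (IsCMField.complexConj L) 2).Adelic → ℂ} (hφV : φ ∈ chiSectionSpace χ ((standardMaximalCompactGL 2 L).comap (adelicVal ↥(maximalRealSubfield L) L (IsCMField.complexConj L) 2 ((StdForm.antidiagonal 2).over L)) : Subgroup (quasiSplit (↥(maximalRealSubfield L)) L (IsCMField.complexConj L) 2).Adelic) (fun _ => 1))
    (hφinf : ∀ a : arch (↥(maximalRealSubfield L)) L (IsCMField.complexConj L) 2 ((StdForm.antidiagonal 2).over L), φ (archToAdelic (↥(maximalRealSubfield L)) L (IsCMField.complexConj L) 2 _ a) = φ 1) (Y : (quasiSplit (↥(maximalRealSubfield L)) L (IsCMField.complexConj L) 2).Adelic) {g : (quasiSplit (↥(maximalRealSubfield L)) L (IsCMField.complexConj L) 2).Adelic} (hg : GLn.sndHom 2 L (adelicVal ↥(maximalRealSubfield L) L (IsCMField.complexConj L) 2 ((StdForm.antidiagonal 2).over L) g) ∈ glFiniteIntegralLevel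 2 L) :
    φ (Y * g) = φ Y := by
  obtain ⟨β, hβ, κ, hκ, rfl⟩ := exists_mem_borelAdelic_mul_mem_standardMaximalCompactGL_cm L Y
  have hκf : GLn.sndHom 2 L (adelicVal ↥(maximalRealSubfield L) L (IsCMField.complexConj L) 2 ((StdForm.antidiagonal 2).over L) κ) ∈ glFiniteIntegralLevel 2 L := ((mem_standardMaximalCompactGL_iff_toMixed_sndHom _).1 hκ).2
  have hκg : GLn.sndHom 2 L (adelicVal ↥(maximalRealSubfield L) L (IsCMField.complexConj L) 2 ((StdForm.antidiagonal 2).over L) (κ * g)) ∈ glFiniteIntegralLevel 2 L := by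
    rw [map_mul, map_mul]; exact Subgroup.mul_mem _ hκf hg
  rw [mul_assoc, isChiSection_of_mem hφV β hβ (κ * g), isChiSection_of_mem hφV β hβ κ, apply_eq_apply_one_of_sndHom_mem hφV hφinf hκg,
    apply_eq_apply_one_of_sndHom_mem hφV hφinf hκf]

/-! ## §2 The archimedean line: M1 sections are constant along it -/

/-- The trace-zero adele `θ(a, 0)` (`a` archimedean) has finite component `0`. [cite: CasselsFrohlichANT1967, Ch. II §14] -/
theorem snd_coe_traceZeroLine_inl {δ : L} (hcδ : IsCMField.complexConj L δ = -δ) (hδ : δ ≠ 0) (a : InfiniteAdeleRing ↥(maximalRealSubfield L)) :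
    ((traceZeroLine ↥(maximalRealSubfield L) L (IsCMField.complexConj L) hcδ hδ ((a, 0) : AdeleRing (𝓞 ↥(maximalRealSubfield L)) ↥(maximalRealSubfield L)) :
        traceZeroAdele ↥(maximalRealSubfield L) L (IsCMField.complexConj L)) : AdeleRing (𝓞 L) L).2 = 0 := by
  have h : ((traceZeroLine ↥(maximalRealSubfield L) L (IsCMField.complexConj L) hcδ hδ ((a, 0) : AdeleRing (𝓞 ↥(maximalRealSubfield L)) ↥(maximalRealSubfield L)) : traceZeroAdele ↥(maximalRealSubfield L) L (IsCMField.complexConj L)) : AdeleRing (𝓞 L) L) =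
      Literature.NumberTheory.Automorphic.AdeleRing.baseChange ↥(maximalRealSubfield L) L ((a, 0) : AdeleRing (𝓞 ↥(maximalRealSubfield L)) ↥(maximalRealSubfield L)) * algebraMap L (AdeleRing (𝓞 L) L) δ := rfl
  have h2 : ∀ x y : AdeleRing (𝓞 L) L, (x * y).2 = x.2 * y.2 := fun _ _ => rfl
  have h3 : (((a, 0) : AdeleRing (𝓞 ↥(maximalRealSubfield L)) ↥(maximalRealSubfield L))).2 = 0 := rfl
  rw [h, h2, Literature.NumberTheory.Automorphic.AdeleRing.baseChange_snd, h3, map_zero, zero_mul]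

/-- **The finite component of `n(θ(a, 0))` is `1`** (`π(n b) = 1 + b E₀₁`, and `θ(a,0)_f = 0`). [cite: Rogawski1990, §1.10] -/
theorem sndHom_adelicVal_middleRootUnipotent_inl {δ : L} (hcδ : IsCMField.complexConj L δ = -δ) (hδ : δ ≠ 0) (a : InfiniteAdeleRing ↥(maximalRealSubfield L)) :
    GLn.sndHom 2 L (adelicVal ↥(maximalRealSubfield L) L (IsCMField.complexConj L) 2 ((StdForm.antidiagonal 2).over L) ((middleRootUnipotent hij hN (Multiplicative.ofAdd (traceZeroLine ↥(maximalRealSubfield L) L (IsCMField.complexConj L) hcδ hδ ((a, 0) : AdeleRing (𝓞 ↥(maximalRealSubfield L)) ↥(maximalRealSubfield L)))) : ↥(adelicUnipotent ↥(maximalRealSubfield L) L (IsCMField.complexConj L) 2)) : (quasiSplit (↥(maximalRealSubfield L)) L (IsCMField.complexConj L) 2).Adelic)) = 1 := by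
  refine Matrix.GeneralLinearGroup.ext fun i j => ?_
  change (((adelicVal ↥(maximalRealSubfield L) L (IsCMField.complexConj L) 2 ((StdForm.antidiagonal 2).over L) ((middleRootUnipotent hij hN (Multiplicative.ofAdd (traceZeroLine ↥(maximalRealSubfield L) L (IsCMField.complexConj L) hcδ hδ ((a, 0) : AdeleRing (𝓞 ↥(maximalRealSubfield L)) ↥(maximalRealSubfield L)))) : ↥(adelicUnipotent ↥(maximalRealSubfield L) L (IsCMField.complexConj L) 2)) : (quasiSplit (↥(maximalRealSubfield L)) L (IsCMField.complexConj L) 2).Adelic) : GL (Fin 2) (AdeleRing (𝓞 L) L)) : Matrix (Fin 2) (Fin 2) (AdeleRing (𝓞 L) L)) i j).2 =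
    ((1 : GL (Fin 2) (FiniteAdeleRing (𝓞 L) L)) : Matrix (Fin 2) (Fin 2) (FiniteAdeleRing (𝓞 L) L)) i j
  have hadd : ∀ x y : AdeleRing (𝓞 L) L, (x + y).2 = x.2 + y.2 := fun _ _ => rfl
  have hone : ((1 : AdeleRing (𝓞 L) L)).2 = 1 := rfl
  have hzero : ((0 : AdeleRing (𝓞 L) L)).2 = 0 := rfl
  rw [coe_adelicVal_middleRootUnipotent_two, Units.val_one, Matrix.add_apply, hadd, Matrix.single_apply]
  by_cases h : (0 : Fin 2) = i ∧ (1 : Fin 2) = j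
  · obtain ⟨rfl, rfl⟩ := h
    rw [if_pos ⟨rfl, rfl⟩, snd_coe_traceZeroLine_inl L hcδ hδ a, add_zero, Matrix.one_apply_ne (by decide), Matrix.one_apply_ne (by decide), hzero]
  · rw [if_neg h, hzero, add_zero]
    by_cases hij' : i = j
    · subst hij'; rw [Matrix.one_apply_eq, Matrix.one_apply_eq, hone]
    · rw [Matrix.one_apply_ne hij', Matrix.one_apply_ne hij', hzero]

/-- **M1 SECTIONS ARE CONSTANT ALONG THE arch (↥(maximalRealSubfield L)) L (IsCMField.complexConj L) 2 ((StdForm.antidiagonal 2).over L)IMEDEAN LINE**: for `φ ∈ V(χ, K_max, 1)` with `φ ∘ ι_∞ = φ(1)`, `k ∈ K_max`, `b ∈ 𝔸_{L⁺}^∞` and every archimedean `a`,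
`φ(ι(w₀)·n(θ(a, b))·k) = φ(ι(w₀)·n(θ(0, b)))` (`θ` additive, ★ `middleRootUnipotent_add_two`, §1 with `g = n(θ(a,0))·k`). [cite: MoeglinWaldspurger1995, I.2.10–I.2.12, II.1.5] -/
theorem apply_line_eq_maximalLevel {δ : L} (hcδ : IsCMField.complexConj L δ = -δ) (hδ : δ ≠ 0) {χ : HeckeCharacter L} {φ : (quasiSplit (↥(maximalRealSubfield L)) L (IsCMField.complexConj L) 2).Adelic → ℂ}
    (hφV : φ ∈ chiSectionSpace χ ((standardMaximalCompactGL 2 L).comap (adelicVal ↥(maximalRealSubfield L) L (IsCMField.complexConj L) 2 ((StdForm.antidiagonal 2).over L)) : Subgroup (quasiSplit (↥(maximalRealSubfield L)) L (IsCMField.complexConj L) 2).Adelic) (fun _ => 1)) (hφinf : ∀ a : arch (↥(maximalRealSubfield L)) L (IsCMField.complexConj L) 2 ((StdForm.antidiagonal 2).over L), φ (archToAdelic (↥(maximalRealSubfield L)) L (IsCMField.complexConj L) 2 _ a) = φ 1)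
    {k : (quasiSplit (↥(maximalRealSubfield L)) L (IsCMField.complexConj L) 2).Adelic} (hk : k ∈ ((standardMaximalCompactGL 2 L).comap (adelicVal ↥(maximalRealSubfield L) L (IsCMField.complexConj L) 2 ((StdForm.antidiagonal 2).over L)) : Subgroup (quasiSplit (↥(maximalRealSubfield L)) L (IsCMField.complexConj L) 2).Adelic)) (b : FiniteAdeleRing (𝓞 ↥(maximalRealSubfield L)) ↥(maximalRealSubfield L)) (a : InfiniteAdeleRing ↥(maximalRealSubfield L)) :
    φ (((quasiSplit (↥(maximalRealSubfield L)) L (IsCMField.complexConj L) 2).toAdelic (weylLongU ((IsCMField.complexConj L : L ≃ₐ[↥(maximalRealSubfield L)] L) : L →+* L) (rfl : ((StdForm.antidiagonal 2).over L) = ((StdForm.antidiagonal 2).over L)))) * ((middleRootUnipotent hij hN (Multiplicative.ofAdd (traceZeroLine ↥(maximalRealSubfield L) L (IsCMField.complexConj L) hcδ hδ ((a, b) : AdeleRing (𝓞 ↥(maximalRealSubfield L)) ↥(maximalRealSubfield L)))) : ↥(adelicUnipotent ↥(maximalRealSubfield L) L (IsCMField.complexConj L) 2)) : (quasiSplit (↥(maximalRealSubfield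 L)) L (IsCMField.complexConj L) 2).Adelic) * k) = φ (((quasiSplit (↥(maximalRealSubfield L)) L (IsCMField.complexConj L) 2).toAdelic (weylLongU ((IsCMField.complexConj L : L ≃ₐ[↥(maximalRealSubfield L)] L) : L →+* L) (rfl : ((StdForm.antidiagonal 2).over L) = ((StdForm.antidiagonal 2).over L)))) * ((middleRootUnipotent hij hN (Multiplicative.ofAdd (traceZeroLine ↥(maximalRealSubfield L) L (IsCMField.complexConj L) hcδ hδ ((0, b) : AdeleRing (𝓞 ↥(maximalRealSubfield L)) ↥(maximalRealSubfield L)))) : ↥(adelicUnipotent ↥(maximalRealSubfield L) L (IsCMField.complexConj L) 2)) : (quasiSplit (↥(maximalRealSubfield L)) L (IsCMField.complexConj L) 2).Adelic)) := by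
  have hsplit : traceZeroLine ↥(maximalRealSubfield L) L (IsCMField.complexConj L) hcδ hδ ((a, b) : AdeleRing (𝓞 ↥(maximalRealSubfield L)) ↥(maximalRealSubfield L)) = traceZeroLine ↥(maximalRealSubfield L) L (IsCMField.complexConj L) hcδ hδ ((0, b) : AdeleRing (𝓞 ↥(maximalRealSubfield L)) ↥(maximalRealSubfield L)) + traceZeroLine ↥(maximalRealSubfield L) L (IsCMField.complexConj L) hcδ hδ ((a, 0) : AdeleRing (𝓞 ↥(maximalRealSubfield L)) ↥(maximalRealSubfield L)) := by
    rw [← map_add]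
    congr 1
    exact Prod.ext (zero_add a).symm (add_zero b).symm
  have hkf : GLn.sndHom 2 L (adelicVal ↥(maximalRealSubfield L) L (IsCMField.complexConj L) 2 ((StdForm.antidiagonal 2).over L) k) ∈ glFiniteIntegralLevel 2 L := ((mem_standardMaximalCompactGL_iff_toMixed_sndHom _).1 (Subgroup.mem_comap.1 hk)).2
  have hg : GLn.sndHom 2 L (adelicVal ↥(maximalRealSubfield L) L (IsCMField.complexConj L) 2 ((StdForm.antidiagonal 2).over L) (((middleRootUnipotent hij hN (Multiplicative.ofAdd (traceZeroLine ↥(maximalRealSubfield L) L (IsCMField.complexConj L) hcδ hδ ((a, 0) : AdeleRing (𝓞 ↥(maximalRealSubfield L)) ↥(maximalRealSubfield L)))) : ↥(adelicUnipotent ↥(maximalRealSubfield L) L (IsCMField.complexConj L) 2)) : (quasiSplit (↥(maximalRealSubfield L)) L (IsCMField.complexConj L) 2).Adelic) * k)) ∈ glFiniteIntegralLevel 2 L := by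
    rw [map_mul, map_mul, sndHom_adelicVal_middleRootUnipotent_inl L hij hN hcδ hδ a, one_mul]; exact hkf
  rw [hsplit, middleRootUnipotent_add_two hij hN, Subgroup.coe_mul]
  have hass : ((quasiSplit (↥(maximalRealSubfield L)) L (IsCMField.complexConj L) 2).toAdelic (weylLongU ((IsCMField.complexConj L : L ≃ₐ[↥(maximalRealSubfield L)] L) : L →+* L) (rfl : ((StdForm.antidiagonal 2).over L) = ((StdForm.antidiagonal 2).over L)))) * (((middleRootUnipotent hij hN (Multiplicative.ofAdd (traceZeroLine ↥(maximalRealSubfield L) L (IsCMField.complexConj L) hcδ hδ ((0, b) : AdeleRing (𝓞 ↥(maximalRealSubfield L)) ↥(maximalRealSubfield L)))) : ↥(adelicUnipotent ↥(maximalRealSubfield L) L (IsCMField.complexConj L) 2)) : (quasiSplit (↥(maximalRealSubfield L)) L (IsCMField.complexConj L) 2).Adelic) * ((middleRootUnipotent hij hN (Multiplicative.ofAdd (traceZeroLine ↥(maximalRealSubfield L) L (IsCMField.complexConj L) hcδ hδ ((a, 0) : AdeleRing (𝓞 ↥(maximalRealSubfield L)) ↥(maximalRealSubfield L)))) : ↥(adelicUnipotent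 ↥(maximalRealSubfield L) L (IsCMField.complexConj L) 2)) : (quasiSplit (↥(maximalRealSubfield L)) L (IsCMField.complexConj L) 2).Adelic)) * k =
      ((quasiSplit (↥(maximalRealSubfield L)) L (IsCMField.complexConj L) 2).toAdelic (weylLongU ((IsCMField.complexConj L : L ≃ₐ[↥(maximalRealSubfield L)] L) : L →+* L) (rfl : ((StdForm.antidiagonal 2).over L) = ((StdForm.antidiagonal 2).over L)))) * ((middleRootUnipotent hij hN (Multiplicative.ofAdd (traceZeroLine ↥(maximalRealSubfield L) L (IsCMField.complexConj L) hcδ hδ ((0, b) : AdeleRing (𝓞 ↥(maximalRealSubfield L)) ↥(maximalRealSubfield L)))) : ↥(adelicUnipotent ↥(maximalRealSubfield L) L (IsCMField.complexConj L) 2)) : (quasiSplit (↥(maximalRealSubfield L)) L (IsCMField.complexConj L) 2).Adelic) * (((middleRootUnipotent hij hN (Multiplicative.ofAdd (traceZeroLine ↥(maximalRealSubfield L) L (IsCMField.complexConj L) hcδ hδ ((a, 0) : AdeleRing (𝓞 ↥(maximalRealSubfield L)) ↥(maximalRealSubfield L)))) : ↥(adelicUnipotent ↥(maximalRealSubfield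 L) L (IsCMField.complexConj L) 2)) : (quasiSplit (↥(maximalRealSubfield L)) L (IsCMField.complexConj L) 2).Adelic) * k) := by
    simp only [mul_assoc]
  rw [hass]
  exact apply_mul_eq_of_sndHom_mem L hφV hφinf _ hg

/-! ## §3 The archimedean smoothness binder `hφarch` for M1 sections -/

/-- **`hφarch` FOR M1 SECTIONS**: for `φ ∈ V(χ, K_max, 1)` with `φ ∘ ι_∞ = φ(1)` and `‖φ‖ ≤ C_φ`, the flat section `f_z = φ·H^z` satisfies the archimedean smoothness binder of ★
`exists_bound_sub_borelConstantTerm_level_cm_two_of_archSmooth` VERBATIM (§2 ⟹ ★ `lineSymbol_of_archConstant` ⟹ ★ `exists_archSmooth_flatSectionU_of_lineSymbol_cm_two`).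
[cite: MoeglinWaldspurger1995, I.2.10–I.2.12, II.1.5] [cite: Garrett2018, §2.2] -/
theorem exists_archSmooth_flatSectionU_maximalLevel_cm_two {δ : L} (hcδ : IsCMField.complexConj L δ = -δ) (hδ : δ ≠ 0) (z : ℂ) (m : ℕ)
    {χ : HeckeCharacter L} {φ : (quasiSplit (↥(maximalRealSubfield L)) L (IsCMField.complexConj L) 2).Adelic → ℂ} (hφV : φ ∈ chiSectionSpace χ ((standardMaximalCompactGL 2 L).comap (adelicVal ↥(maximalRealSubfield L) L (IsCMField.complexConj L) 2 ((StdForm.antidiagonal 2).over L)) : Subgroup (quasiSplit (↥(maximalRealSubfield L)) L (IsCMField.complexConj L) 2).Adelic) (fun _ => 1)) (hφinf : ∀ a : arch (↥(maximalRealSubfield L)) L (IsCMField.complexConj L) 2 ((StdForm.antidiagonal 2).over L), φ (archToAdelic (↥(maximalRealSubfield L)) L (IsCMField.complexConj L) 2 _ a) = φ 1) {Cφ : ℝ} (hφC : ∀ x, ‖φ x‖ ≤ Cφ) :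
    ∃ Cφ : ℝ, 0 ≤ Cφ ∧
    ∀ k ∈ ((standardMaximalCompactGL 2 L).comap (adelicVal ↥(maximalRealSubfield L) L (IsCMField.complexConj L) 2 ((StdForm.antidiagonal 2).over L)) : Subgroup (quasiSplit (↥(maximalRealSubfield L)) L (IsCMField.complexConj L) 2).Adelic), ∀ b : FiniteAdeleRing (𝓞 ↥(maximalRealSubfield L)) ↥(maximalRealSubfield L),
      ContDiff ℝ m ((fun a : InfiniteAdeleRing ↥(maximalRealSubfield L) => flatSectionU φ z (((quasiSplit (↥(maximalRealSubfield L)) L (IsCMField.complexConj L) 2).toAdelic (weylLongU ((IsCMField.complexConj L : L ≃ₐ[↥(maximalRealSubfield L)] L) : L →+* L) (rfl : ((StdForm.antidiagonal 2).over L) = ((StdForm.antidiagonal 2).over L)))) *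
          ((middleRootUnipotent hij hN (Multiplicative.ofAdd (traceZeroLine ↥(maximalRealSubfield L) L (IsCMField.complexConj L) hcδ hδ ((a, b) : AdeleRing (𝓞 ↥(maximalRealSubfield L)) ↥(maximalRealSubfield L)))) : ↥(adelicUnipotent ↥(maximalRealSubfield L) L (IsCMField.complexConj L) 2)) : (quasiSplit (↥(maximalRealSubfield L)) L (IsCMField.complexConj L) 2).Adelic) * k)) ∘ (InfiniteAdeleRing.ringEquiv_mixedSpace ↥(maximalRealSubfield L)).symm) ∧
      ∀ j : ℕ, j ≤ m → ∀ s : mixedSpace ↥(maximalRealSubfield L),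
        ‖iteratedFDeriv ℝ j ((fun a : InfiniteAdeleRing ↥(maximalRealSubfield L) => flatSectionU φ z (((quasiSplit (↥(maximalRealSubfield L)) L (IsCMField.complexConj L) 2).toAdelic (weylLongU ((IsCMField.complexConj L : L ≃ₐ[↥(maximalRealSubfield L)] L) : L →+* L) (rfl : ((StdForm.antidiagonal 2).over L) = ((StdForm.antidiagonal 2).over L)))) *
          ((middleRootUnipotent hij hN (Multiplicative.ofAdd (traceZeroLine ↥(maximalRealSubfield L) L (IsCMField.complexConj L) hcδ hδ ((a, b) : AdeleRing (𝓞 ↥(maximalRealSubfield L)) ↥(maximalRealSubfield L)))) : ↥(adelicUnipotent ↥(maximalRealSubfield L) L (IsCMField.complexConj L) 2)) : (quasiSplit (↥(maximalRealSubfield L)) L (IsCMField.complexConj L) 2).Adelic) * k)) ∘ (InfiniteAdeleRing.ringEquiv_mixedSpace ↥(maximalRealSubfield L)).symm) s‖ ≤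
          Cφ * (borelHeight (((quasiSplit (↥(maximalRealSubfield L)) L (IsCMField.complexConj L) 2).toAdelic (weylLongU ((IsCMField.complexConj L : L ≃ₐ[↥(maximalRealSubfield L)] L) : L →+* L) (rfl : ((StdForm.antidiagonal 2).over L) = ((StdForm.antidiagonal 2).over L)))) *
          ((middleRootUnipotent hij hN (Multiplicative.ofAdd (traceZeroLine ↥(maximalRealSubfield L) L (IsCMField.complexConj L) hcδ hδ (((InfiniteAdeleRing.ringEquiv_mixedSpace ↥(maximalRealSubfield L)).symm s, b) : AdeleRing (𝓞 ↥(maximalRealSubfield L)) ↥(maximalRealSubfield L)))) : ↥(adelicUnipotent ↥(maximalRealSubfield L) L (IsCMField.complexConj L) 2)) : (quasiSplit (↥(maximalRealSubfield L)) L (IsCMField.complexConj L) 2).Adelic) * k) : ℝ) ^ z.re := by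
  have hM : ∀ g, ‖φ g‖ ≤ max Cφ 0 := fun g => (hφC g).trans (le_max_left _ _)
  have hsym := lineSymbol_of_archConstant L hij hN hcδ hδ m hM fun k hk b s s' => by
    simp only [Function.comp_apply]
    rw [apply_line_eq_maximalLevel L hij hN hcδ hδ hφV hφinf hk, apply_line_eq_maximalLevel L hij hN hcδ hδ hφV hφinf hk]
  exact exists_archSmooth_flatSectionU_of_lineSymbol_cm_two L hij hN hcδ hδ z m (le_max_right _ _) hsym

/-! ## §4 HEAD: the decay letter `hdec′` at M1 -/

/-- **THE DECAY LETTER `hdec′` OF ★ B1 `inner_truncatedFamily_eq_fourTerm_chi_cm_two`, DISCHARGED AT M1.**  For a unitary Hecke character `χ` of `L`, `T ≥ 1`, and a continuous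
bounded section `φ′ ∈ V(χ, K_max, 1)` with `φ′ ∘ ι_∞ = φ′(1)`: for every `z′` with `1 < Re z′` there is `M₁` with `‖E(f′_{z′})(g) − E_B(f′_{z′})(g)‖ ≤ M₁` whenever `H(g) > T`
(★ p857911 edition B′ with `hφB`, `hf`, `hφU`, `hφarch` ALL discharged; `δ`, the indices, `m = [L⁺:ℚ] + 1` and the additive Haar measures are chosen inside).
[cite: MoeglinWaldspurger1995, I.2.13, II.1.7] [cite: Garrett2018, §2.10] -/
theorem hdec'_maximalLevel_cm_two
    [MeasurableSpace (quasiSplit (↥(maximalRealSubfield L)) L (IsCMField.complexConj L) 2).Adelic] [BorelSpace (quasiSplit (↥(maximalRealSubfield L)) L (IsCMField.complexConj L) 2).Adelic]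
    (ν : Measure ↥(adelicUnipotent ↥(maximalRealSubfield L) L (IsCMField.complexConj L) 2)) [ν.IsHaarMeasure]
    {𝓕 : Set ↥(adelicUnipotent ↥(maximalRealSubfield L) L (IsCMField.complexConj L) 2)}
    (h𝓕N : IsFundamentalDomain ↥(rationalUnipotent ↥(maximalRealSubfield L) L (IsCMField.complexConj L) 2) 𝓕 ν) (h𝓕c : IsCompact (closure 𝓕))
    {T : ℝ≥0} (hT : 1 ≤ T) {χ : HeckeCharacter L} (hχ : χ.IsUnitary)
    {φ' : (quasiSplit (↥(maximalRealSubfield L)) L (IsCMField.complexConj L) 2).Adelic → ℂ} (hφ'V : φ' ∈ chiSectionSpace χ ((standardMaximalCompactGL 2 L).comap (adelicVal ↥(maximalRealSubfield L) L (IsCMField.complexConj L) 2 ((StdForm.antidiagonal 2).over L)) : Subgroup (quasiSplit (↥(maximalRealSubfield L)) L (IsCMField.complexConj L) 2).Adelic) (fun _ => 1)) (hφ'c : Continuous φ') {Cφ' : ℝ} (hφ'C : ∀ x, ‖φ' x‖ ≤ Cφ')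
    (hφ'inf : ∀ a : arch (↥(maximalRealSubfield L)) L (IsCMField.complexConj L) 2 ((StdForm.antidiagonal 2).over L), φ' (archToAdelic (↥(maximalRealSubfield L)) L (IsCMField.complexConj L) 2 _ a) = φ' 1) :
    ∀ z' : ℂ, 1 < z'.re → ∃ M₁ : ℝ, ∀ g : (quasiSplit (↥(maximalRealSubfield L)) L (IsCMField.complexConj L) 2).Adelic, T < borelHeight g →
      ‖eisensteinSeriesU (flatSectionU φ' z') g - borelConstantTerm ν 𝓕 (eisensteinSeriesU (flatSectionU φ' z')) g‖ ≤ M₁ := by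
  intro z' hz'
  -- auxiliary structures (not in the statement): Borel structures and additive Haar measures of `𝔸_{L⁺}`, `𝔸_{L⁺,∞}`, `𝔸_{L⁺,f}`
  letI : MeasurableSpace (AdeleRing (𝓞 L) L) := borel _
  haveI : BorelSpace (AdeleRing (𝓞 L) L) := ⟨rfl⟩
  letI : MeasurableSpace (AdeleRing (𝓞 ↥(maximalRealSubfield L)) ↥(maximalRealSubfield L)) := borel _
  haveI : BorelSpace (AdeleRing (𝓞 ↥(maximalRealSubfield L)) ↥(maximalRealSubfield L)) := ⟨rfl⟩
  letI : MeasurableSpace (InfiniteAdeleRing ↥(maximalRealSubfield L)) := borel _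
  haveI : BorelSpace (InfiniteAdeleRing ↥(maximalRealSubfield L)) := ⟨rfl⟩
  letI : MeasurableSpace (FiniteAdeleRing (𝓞 ↥(maximalRealSubfield L)) ↥(maximalRealSubfield L)) := borel _
  haveI : BorelSpace (FiniteAdeleRing (𝓞 ↥(maximalRealSubfield L)) ↥(maximalRealSubfield L)) := ⟨rfl⟩
  haveI := locallyCompactSpace_adeleRing' ↥(maximalRealSubfield L)
  haveI := locallyCompactSpace_finiteAdeleRing' ↥(maximalRealSubfield L)
  -- a totally imaginary generator `δ = e − ē ≠ 0` and the indices of the middle root of `U(J₂)`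
  obtain ⟨e, he⟩ := Literature.NumberTheory.NumberFields.IsCMField.exists_complexConj_ne L
  have hcδ : IsCMField.complexConj L (e - IsCMField.complexConj L e) = -(e - IsCMField.complexConj L e) := by
    rw [map_sub, IsCMField.complexConj_apply_apply, neg_sub]
  have hδ : e - IsCMField.complexConj L e ≠ 0 := sub_ne_zero.2 (Ne.symm he)
  have hij : (((0 : Fin 2) : ℕ)) + 1 = ((1 : Fin 2) : ℕ) := rfl
  have hN : 2 = 2 * ((0 : Fin 2) : ℕ) + 2 := rfl
  -- `hφarch` (§3) at `m = [L⁺:ℚ] + 1`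
  obtain ⟨Cφ, hCφ, hφarch⟩ := exists_archSmooth_flatSectionU_maximalLevel_cm_two L hij hN hcδ hδ z' (finrank ℚ ↥(maximalRealSubfield L) + 1) hφ'V hφ'inf hφ'C
  -- `hφU` at `U₀ = GL₂(𝒪̂_L)`: the trivial `K_max`-type
  have hφU : ∀ u : (quasiSplit (↥(maximalRealSubfield L)) L (IsCMField.complexConj L) 2).Adelic, adelicVal ↥(maximalRealSubfield L) L (IsCMField.complexConj L) 2 ((StdForm.antidiagonal 2).over L) u ∈ (glFiniteIntegralLevel 2 L).map (GLn.ofFinite 2 L) → ∀ y : (quasiSplit (↥(maximalRealSubfield L)) L (IsCMField.complexConj L) 2).Adelic, φ' (y * u) = φ' y := fun u hu y => by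
    obtain ⟨x, hx, hxu⟩ := Subgroup.mem_map.1 hu
    have hmem : u ∈ ((standardMaximalCompactGL 2 L).comap (adelicVal ↥(maximalRealSubfield L) L (IsCMField.complexConj L) 2 ((StdForm.antidiagonal 2).over L)) : Subgroup (quasiSplit (↥(maximalRealSubfield L)) L (IsCMField.complexConj L) 2).Adelic) := by
      refine Subgroup.mem_comap.2 ((mem_standardMaximalCompactGL_iff_toMixed_sndHom _).2 ⟨?_, ?_⟩)
      · rw [← hxu, GLn.toMixed_ofFinite]; exact (Kinf 2 L).one_mem
      · rw [← hxu, GLn.sndHom_ofFinite]; exact hx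
    have e1 := ((mem_chiSectionSpace_iff _).1 hφ'V).2 y ⟨u, hmem⟩
    simpa only [one_mul] using e1
  exact exists_bound_sub_borelConstantTerm_level_cm_two_of_archSmooth L hij hN hcδ hδ ν h𝓕N h𝓕c
    (Measure.addHaar : Measure (AdeleRing (𝓞 ↥(maximalRealSubfield L)) ↥(maximalRealSubfield L))) (Measure.addHaar : Measure (InfiniteAdeleRing ↥(maximalRealSubfield L)))
    (Measure.addHaar : Measure (FiniteAdeleRing (𝓞 ↥(maximalRealSubfield L)) ↥(maximalRealSubfield L))) χ hχ hz' hφ'c hφ'C (isChiSection_of_mem hφ'V).toAdelic_mul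
    ((isChiSection_of_mem hφ'V).borelLaw_flatSectionU z') (isOpen_glFiniteIntegralLevel 2 L) le_rfl hφU hT (m := finrank ℚ ↥(maximalRealSubfield L) + 1)
    (by push_cast; linarith) hCφ hφarch

/-- **The same letter in the `σ1` byte shape of ★ p860692 `chi_scattering_real_poles_m1_final_cm_two`** (K2E1-p13 (g3)'s (d)-column LETTER TABLE, bus `K2/STATUS.md`
2026-09-04T13:40:30Z): the level `T ≥ 1` universally quantified inside — `hdec : ∀ T ≥ 1, ∀ z′ (1 < Re z′), ∃ M₁, ∀ g, T < H(g) → ‖E(f_{z′}^φ)(g) − E_B(f_{z′}^φ)(g)‖ ≤ M₁` for the M1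
family `φ` itself (ED. 2, append-only). [cite: MoeglinWaldspurger1995, I.2.13, II.1.7] [cite: Garrett2018, §2.10] -/
theorem hdec_maximalLevel_cm_two
    [MeasurableSpace (quasiSplit (↥(maximalRealSubfield L)) L (IsCMField.complexConj L) 2).Adelic] [BorelSpace (quasiSplit (↥(maximalRealSubfield L)) L (IsCMField.complexConj L) 2).Adelic]
    (ν : Measure ↥(adelicUnipotent ↥(maximalRealSubfield L) L (IsCMField.complexConj L) 2)) [ν.IsHaarMeasure]
    {𝓕 : Set ↥(adelicUnipotent ↥(maximalRealSubfield L) L (IsCMField.complexConj L) 2)}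
    (h𝓕N : IsFundamentalDomain ↥(rationalUnipotent ↥(maximalRealSubfield L) L (IsCMField.complexConj L) 2) 𝓕 ν) (h𝓕c : IsCompact (closure 𝓕))
    {χ : HeckeCharacter L} (hχ : χ.IsUnitary)
    {φ : (quasiSplit (↥(maximalRealSubfield L)) L (IsCMField.complexConj L) 2).Adelic → ℂ} (hφV : φ ∈ chiSectionSpace χ ((standardMaximalCompactGL 2 L).comap (adelicVal ↥(maximalRealSubfield L) L (IsCMField.complexConj L) 2 ((StdForm.antidiagonal 2).over L)) : Subgroup (quasiSplit (↥(maximalRealSubfield L)) L (IsCMField.complexConj L) 2).Adelic) (fun _ => 1)) (hφc : Continuous φ) {Cφ : ℝ} (hφC : ∀ x, ‖φ x‖ ≤ Cφ)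
    (hφinf : ∀ a : arch (↥(maximalRealSubfield L)) L (IsCMField.complexConj L) 2 ((StdForm.antidiagonal 2).over L), φ (archToAdelic (↥(maximalRealSubfield L)) L (IsCMField.complexConj L) 2 _ a) = φ 1) :
    ∀ T : ℝ≥0, 1 ≤ T → ∀ z' : ℂ, 1 < z'.re → ∃ M₁ : ℝ, ∀ g : (quasiSplit (↥(maximalRealSubfield L)) L (IsCMField.complexConj L) 2).Adelic, T < borelHeight g →
      ‖eisensteinSeriesU (flatSectionU φ z') g - borelConstantTerm ν 𝓕 (eisensteinSeriesU (flatSectionU φ z')) g‖ ≤ M₁ :=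
  fun _ hT z' hz' => hdec'_maximalLevel_cm_two L ν h𝓕N h𝓕c hT hχ hφV hφc hφC hφinf z' hz'

end Summit.HodgeConjecture.HodgeConjecture.Cruxes.H413.K2E1ChiMaassSelbergDecayLetterM1CMTwo

end
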